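import Summits.QuantumFields.BalabanUV.T4Continuum.Support.B13StepEnvelopeEnd
import Summits.QuantumFields.BalabanUV.T4Continuum.Support.B13StepOfRecordSecantTermwiseWitness

/-!
# NE5 ∕ U3 — NON-VACUITY WITNESS for the CAUCHY END of record (`B13StepEnvelopeEnd.ne5_of_record_envelope_actNormDecay`, E9[rec]):
# leaf-10's ZERO slot package `zeroSlots R` satisfies EVERY one of its displayed binders — the END FIRES on Bałaban's carriers of record

Cell `pub-balaban`, unit `b2b-balaban-t4-ne5-formalise-leaf-03` (NE5 formalisation swarm, LEAF PROVER 03, gen 5; companion of this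
lineage's `Support/B13StepEnvelopeEnd.lean`, in the pattern of leaf-10's `B13StepEndWitness` p211760 (E1[rec]) and leaf-01's
`B13StepOfRecordSecantTermwiseWitness` p213787 (E8[rec] termwise)).  Summits-side bookkeeping under the LEAN PLACEMENT RULE; no new
definition (leaf-10's `zeroSlots`, leaf-01's `zeroActData` BY NAME).  HONEST FRAMING: rung (B)+1 of the FINITE-VOLUME T⁴ programme — NOT
infinite volume, NOT a mass gap, NOT the Clay problem, NOT NE5 (NOT PRINTED; GAPS G-t4-U3-1): a CONSISTENCY witness — the END's binder
list is jointly satisfiable on the carriers of record by the trivial (zero) package; nothing about [Balaban1988RG2Cluster]'s objects, whose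
`Slots` stay PARAMETERS.  HONEST DEPENDENCY (cell line, verbatim): continuum YM on T⁴ ⇐ BetaPertH ∧ nine spine estimates (0/9 proved);
BetaPertH ⇐ (D1) ∧ (D4) ∧ CAP+tail; G-an2-4 gates asym, D1 and NE2/3/4.

WHAT.  For EVERY pair of runs `R : B13Carriers.TwoRuns 𝔾`, window `W` and rate `κ ≥ 0`:
* §1 the two W2 binders of E9[rec] at ACTIVITY level hold for the zero activity on ANY class — `actOpLineAnalyticOn_zero` (operator half:
  the constant `0` is line-analytic) and leaf-01's `actExpLinearOn_zero` (history half: `0 = ∫ 0·e^{0} dδ`); the activity NORM majorant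
  `A ≡ 0` (`actNormBound_zero`), its decay split against `A′ ≡ 0`, and the anchored norm `Φ′ = 0` of `A′` (`anchoredNorm_zero`);
* §2 **`end_fires_zeroSlots_envelope : ∃ C₅, NE5 (outA (zeroSlots R) 0 0) (outB (zeroSlots R) 0 0) W κ θ′ C₅`** for EVERY prescribed rate
  `θ′ ∈ (½, 1]` BY E9[rec] — every
  remaining binder is leaf-10's (`transportReads_zero`, `sliceBudget[B]_zero`, `decayBound_out[A|B]_zero`, `rawBounded_*_zero`,
  `weightedEntrywiseRate_zero`, `floor_zero`, `insertionRate_zero`, `omega_zero`) with radii `ROp := rOp`, `RHist := bHist 0 0 + rHist`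
  and the numbers `(E₁, r₀, θ, ρ₀) = (1, 1, ½, ½)`, all other letters `0` (note `ρ₀ = ½ < 1`: the Cauchy route's strict reach; the
  secant-route witnesses of leaf-10 ∕ leaf-01 fix `θ′ = 1` — here `θ′` is free in `(½, 1]`, a distinct and slightly sharper statement).
So E9[rec]'s ≈ 40-binder displayed list has NO hidden clash (signs, radii, the `G∕(1 − ρ₀)` smallness, the anchored-norm currency).
0 sorry; axioms ⊆ {propext, Classical.choice, Quot.sound}.
-/

noncomputable section

open scoped BigOperators
open Metric Set MeasureTheory

namespace Summit.QuantumFields.BalabanUV.T4Continuum.B13StepEnvelopeEndWitness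

open Literature.MathematicalPhysics.QuantumFieldTheory.Balaban1983to89
open Literature.MathematicalPhysics.QuantumFieldTheory.Balaban1983to89.T4OutputRate (NE5)
open Summit.QuantumFields.BalabanUV.T4Continuum.B13Carriers (TwoRuns)
open Summit.QuantumFields.BalabanUV.T4Continuum.B13OpDatum (OpDatum)
open Summit.QuantumFields.BalabanUV.T4Continuum.B13StepTermLabels (TermIdx InnerLabel)
open Summit.QuantumFields.BalabanUV.T4Continuum.B13StepTermSocket (labelsIndexing touchInc)
open Summit.QuantumFields.BalabanUV.T4Continuum.B13InnerData (Bnd b13InnerData)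
open Summit.QuantumFields.BalabanUV.T4Continuum.UrsellTreeSum (ind)
open Summit.QuantumFields.BalabanUV.T4Continuum.UrsellTermBudget (actSum)
open Summit.QuantumFields.BalabanUV.T4Continuum.B13Represents (Assembly)
open Summit.QuantumFields.BalabanUV.T4Continuum.B13DomainGeometryTR (SCube footprint domainGeometry)
open Summit.QuantumFields.BalabanUV.T4Continuum.B13StepOfRecord (assembly step outA outB)
open Summit.QuantumFields.BalabanUV.T4Continuum.B13StepEndWitness
  (zeroSlots transportReads_zero sliceBudgetB_zero sliceBudget_zero decayBound_outA_zero decayBound_outB_zero rawBounded_rawAt_zero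
  rawBounded_rawB_zero weightedEntrywiseRate_zero floor_zero insertionRate_zero omega_zero)
open Summit.QuantumFields.BalabanUV.T4Continuum.B13StepOfRecordSecantTermwiseWitness (zeroActData actExpLinearOn_zero)
open Summit.QuantumFields.BalabanUV.T4Continuum.B13TermOpEnvelope (ActOpLineAnalyticOn)
open Summit.QuantumFields.BalabanUV.T4Continuum.B13StepEnvelopeEnd (ne5_of_record_envelope_actNormDecay)

variable {𝔾 : Type} [GaugeGroup 𝔾] (R : TwoRuns 𝔾) (W : Set (ℕ → ℝ))

/-! ## §1 The activity-level binders of E9[rec] at zero -/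

/-- [folklore] **W2-op AT FACTOR LEVEL** for the zero activity on ANY class: the constant `0` is operator-line analytic. -/
theorem actOpLineAnalyticOn_zero (K : ℕ → (ℕ → ℝ) → R.carriers.BgB → Set (OpDatum Unit × ℂ)) :
    ActOpLineAnalyticOn (labelsIndexing (domainGeometry R) (b13InnerData R)) (zeroSlots R).act K W :=
  fun _ _ _ _ _ _ _ _ _ _ _ _ _ => by
    show DifferentiableOn ℂ (fun _ : ℂ => (0 : ℂ)) (closedBall 0 1)
    exact differentiableOn_const 0

/-- [folklore] The activity NORM majorant `A ≡ 0` on any class. -/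
theorem actNormBound_zero (K : ℕ → (ℕ → ℝ) → R.carriers.BgB → Set (OpDatum Unit × ℂ)) :
    ∀ k, ∀ g ∈ W, ∀ (U : R.carriers.BgB) (q : OpDatum Unit × ℂ), q ∈ K k g U → ∀ X : R.carriers.Dom, R.carriers.scale X = k →
      ∀ i, (labelsIndexing (domainGeometry R) (b13InnerData R)).Rel k i X → ∀ m,
        ‖(zeroSlots R).act ((labelsIndexing (domainGeometry R) (b13InnerData R)).poly i m)
            ((labelsIndexing (domainGeometry R) (b13InnerData R)).lab i m) q.1 q.2‖ ≤
          (fun (_ : ℕ) (_ : ℕ → ℝ) (_ : R.carriers.BgB) (_ : R.carriers.Dom) (_ : InnerLabel R.carriers.Dom (Bnd R)) => (0 : ℝ))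
            k g U ((labelsIndexing (domainGeometry R) (b13InnerData R)).poly i m)
            ((labelsIndexing (domainGeometry R) (b13InnerData R)).lab i m) :=
  fun _ _ _ _ _ _ _ _ _ _ _ => by simp [zeroSlots]

/-- [folklore] The ANCHORED exponential norm of the zero stripped majorant is `0` (every `actSum` of `0` vanishes). -/
theorem anchoredNorm_zero : ∀ k, ∀ g ∈ W, ∀ (U : R.carriers.BgB) (q : SCube R),
    ∑ Z ∈ R.domAt k, ind (q ∈ footprint Z) *
        actSum (b13InnerData R)
          ((fun (_ : ℕ) (_ : ℕ → ℝ) (_ : R.carriers.BgB) (_ : R.carriers.Dom) (_ : InnerLabel R.carriers.Dom (Bnd R)) => (0 : ℝ)) k g U)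
          k Z * Real.exp ((footprint Z).card) ≤ 0 := by
  intro k g _ U q
  refine le_of_eq (Finset.sum_eq_zero fun Z _ => ?_)
  simp [actSum]

/-! ## §2 The Cauchy END of record FIRES for the zero package -/

/-- [folklore] **NON-VACUITY OF E9[rec] ON BAŁABAN's CARRIERS OF RECORD.**  For EVERY pair of runs `R`, window `W` and rate `κ ≥ 0` the zero
slot package satisfies EVERY hypothesis of `B13StepEnvelopeEnd.ne5_of_record_envelope_actNormDecay` — reading, slice budgets, levels, W1 entry
data, the insertion rate (leaf-10's lemmas BY NAME), radii `ROp := rOp`, `RHist := bHist 0 0 + rHist`, the norm majorant `A ≡ 0` with decay split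
against `A′ ≡ 0` and anchored norm `Φ′ = 0`, **`ActOpLineAnalyticOn` (§1) and `ActExpLinearOn` (leaf-01's `zeroActData`)**, numbers
`(E₁, r₀, θ, ρ₀) = (1, 1, ½, ½)`, all other letters `0`, ANY prescribed rate `θ′ ∈ (½, 1]` — so the END FIRES:
`∃ C₅, NE5 (outA (zeroSlots R) 0 0) (outB (zeroSlots R) 0 0) W κ θ′ C₅`.
The binder list is therefore JOINTLY SATISFIABLE (no hidden clash).  A consistency witness; nothing about [II]'s objects. -/
theorem end_fires_zeroSlots_envelope {κ θ' : ℝ} (hκ : 0 ≤ κ) (hθ' : 1 / 2 < θ') (hθ'1 : θ' ≤ 1) :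
    ∃ C₅, NE5 (outA (zeroSlots R) 0 0) (outB (zeroSlots R) 0 0) W κ θ' C₅ :=
  ⟨_, ne5_of_record_envelope_actNormDecay (zeroSlots R) 0 0 (ROp := (zeroSlots R).rOp)
    (RHist := fun k => (assembly (zeroSlots R)).bHist 0 0 k + (zeroSlots R).rHist k)
    (A := fun _ _ _ _ _ => 0) (A' := fun _ _ _ _ _ => 0) (Dt := zeroActData R) (Φ' := 0) (EA₀ := 0) (E₁ := 1) (cA := 0) (c₁ := 0)
    (r₀ := 1) (δ' := 0) (θ := 1 / 2) (θ' := θ') (ρ₀ := 1 / 2) (B := 0) (k₀ := 0)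
    (transportReads_zero R W) (sliceBudgetB_zero R W κ) (sliceBudget_zero R 0 0 W κ) (decayBound_outA_zero R 0 0 W κ)
    (decayBound_outB_zero R 0 0 W κ) (rawBounded_rawAt_zero R W) (rawBounded_rawB_zero R W)
    (weightedEntrywiseRate_zero R W fun k => (1 / 2 : ℝ) ^ k) (floor_zero R) (insertionRate_zero R 0 0 W κ (1 / 2))
    (fun _ => le_rfl) (fun _ => le_rfl) (actNormBound_zero R W _) (fun _ _ _ _ _ => le_rfl) (fun _ _ _ _ _ => le_rfl) hκ
    (fun _ _ _ _ _ => by simp) le_rfl (by norm_num) (anchoredNorm_zero R W) (actOpLineAnalyticOn_zero R W _)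
    (actExpLinearOn_zero R _ W) le_rfl one_pos le_rfl le_rfl le_rfl one_pos le_rfl (by norm_num) hθ'.le hθ'1
    (by rw [omega_zero]; norm_num) (by rw [omega_zero]; norm_num) (by norm_num)
    (by rw [omega_zero]; norm_num) le_rfl (fun k hk => absurd hk (Nat.not_lt_zero k))
    (by rw [omega_zero]; norm_num; linarith)⟩

/-- [folklore] **READING THE WITNESS**: with the letters above the END's constant evaluates to `0` at every rate — consistent with the zero
outputs (`outA = outB = 0`): `C₅ = ((0∕(1−36·0))∕(1−½)·(0∕1) + (0∕(1−36·0))∕(1−½)·0 + 0)·(θ′ − ½)∕(θ′ − (½ + (0∕(1−36·0))∕(1−½)·0)) = 0`. -/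
example (θ' : ℝ) : ((0 / (1 - 36 * 0) / (1 - 1 / 2) * (0 / 1) + 0 / (1 - 36 * 0) / (1 - 1 / 2) * 0 + 0) * (θ' - 1 / 2) /
    (θ' - (1 / 2 + 0 / (1 - 36 * 0) / (1 - 1 / 2) * 0)) : ℝ) = 0 := by norm_num

end Summit.QuantumFields.BalabanUV.T4Continuum.B13StepEnvelopeEndWitness

end
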